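import Mathlib
import Literature.Computability.Complexity.Circuit
import Literature.Computability.Complexity.CircuitClasses
import Literature.Computability.Complexity.ConstantDepth
import Literature.Computability.Complexity.FormulaComposition
import Literature.Computability.MetaComplexity.FormulaModelsAE
import Literature.Computability.MetaComplexity.XorBottomModelsAE
import Literature.Computability.MetaComplexity.ChenJinWilliams2020.ExplicitObstructions
import Literature.Computability.MetaComplexity.ChenJinWilliams2019.SearchMagnification
import Literature.Computability.MetaComplexity.ChenJinWilliams2019.SparseFormulaMagnification
import Literature.Computability.MetaComplexity.ChenJinWilliams2019.SparseConstantDepthMagnification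
import Literature.Computability.MetaComplexity.OliveiraPichSanthanam2019.GapMKtPBranchingPrograms
import HarnessLib

/-!
# Chen–Jin–Williams 2019, Theorem 1.6 items 2, 6, 7 (`search-MCSP`, `C = PSPACE`) and the
# "Moreover" clause items 2–7 (`search-MKtP`, `C = EXP`) — census row R52, remaining models

L. Chen, C. Jin, R. R. Williams, *Hardness Magnification for all Sparse NP Languages*, FOCS 2019,
1240–1255 [bib: `ChenJinWilliams2019`]; full version ECCC TR19-118 (held text
`paper:url-5c604605311c`, PDF page 5, lines as materialised).  VERBATIM (p. 5 L16–26):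

*"Theorem 1.6. Let C ∈ {⊕P, PP, PSPACE}, and m ≤ s(m) ≤ 2^{(1−Ω(1))m}. Let the input length n = 2^m.
1. If search-MCSP[s(m)] ∉ Circuit[n · poly(s(m))], then C ⊄ Circuit[poly(n)].
2. If search-MCSP[s(m)] ∉ U₂-Formula-⊕[n · poly(s(m))], then C ⊄ Formula[poly(n)].
3. If search-MCSP[s(m)] ∉ B₂-Formula[n² · poly(s(m))], then C ⊄ Formula[poly(n)].
4. If search-MCSP[s(m)] ∉ U₂-Formula[n³ · poly(s(m))], then C ⊄ Formula[poly(n)].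
5. If search-MCSP[s(m)] ∉ BP[n² · poly(s(m))], then C ⊄ BP[poly(n)].
6. If search-MCSP[s(m)] ∉ AC_{d+2}[m*][n · poly(s(m))], then C ⊄ AC_d[m*][poly(n)], for all constants
   d and even integers m* ≥ 2.
7. If there is an ε > 0 such that, for all small enough β > 0, search-MCSP[2^{βm}] ∉
   TC_{d+O(log 1/ε)}[n^{1+ε}], then C ⊄ TC_d[poly(n)], for all constants d.
Moreover, all above implications also hold for C = EXP, with search-MCSP replaced by search-MKtP."*
(Remark 1.7, p. 5 L27–29: one may even demand the lexicographically first witness — "This makes the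
problem harder, and the corresponding lower bound easier to prove"; NOT imposed here, so the typed
hypotheses are the harder-to-prove, i.e. STRONGER, ones — implied direction preserved.)

Items 1, 3, 4, 5 (`C = PSPACE`) and item 1 for `search-MKtP` are `thm16_item1/3/4/5`,
`thm16_MKtP_item1` of `SearchMagnification.lean` (D12: the fixed encoding `encodeCircuit`, the output
convention `SearchMCSPCorrect`, solvability `SearchMCSPSolvableAt 𝒞 s m` / `SearchMKtPSolvableAt U 𝒞 p n`
by tuples of single-output devices from a length-indexed FUNCTION class `𝒞`).  This file adds the three
remaining device models as length-indexed function classes — the per-length constraint lambdas of the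
tree's a.e. LANGUAGE classes, so that model identity with the decision-side rows is literal:

* `formulaXorFns s n` — `U₂-Formula-⊕[s]`: formulas over `formulaXorBasis = deMorganBasis ∪ parityGates`
  with parities only at the bottom and `xorLeafCount ≤ s n` (the constraint of
  `Literature.Computability.MetaComplexity.FORMULAXORae`, CHOPRS note B / OPS p. 4; TR19-118 §1.1,
  p. 3 L22–25: "We consider formulas over the De Morgan basis U2 (NOT, AND(x,y), OR(x,y)), the basis of
  all two-input Boolean functions B2, and extended U2-formulas where the leaves may be constants or
  parities over input bits of arbitrary arity. We denote the corresponding classes for formulas of at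
  most s leaves by U2-Formula[s] (or simply Formula[s]), B2-Formula[s], and U2-Formula-⊕[s],
  respectively." — a constant leaf is the empty parity `⊕₀`, one leaf, in `XorBottomModelsAE`, so the
  typed class contains print's);
* `acModFns m* d M n` — `AC_d[m*][M]`: circuits over `accBasis m* = {¬, ∧ₖ, ∨ₖ, MOD_{m*,k}}`,
  `acDepth ≤ d`, `≤ M n` GATES (the constraint of `ChenJinWilliams2019.ACdModSIZEae`; TR19-118 §1.1,
  p. 3 L17–20: "AC_d[m][s] (circuits of size s(n) and depth d over AND, OR, NOT, and MOD_m gates) and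
  TC_d[s] (threshold circuits of size s(n) and depth d). We measure the size of AC_d[m] circuits by
  number of gates, and the size of TC_d circuits by number of wires.");
* `tcWireFns d w n` — `TC_d[w]`: circuits over linear threshold gates `ltfBasis`, `acDepth ≤ d`,
  `≤ w n` WIRES (the constraint of `ChenJinWilliams2019.TCdWIRESae`; same sentence of p. 3 L19–20).

## Rendering (census rule F2: every typed `Prop` is implied by the printed sentence)

* As in D12: a multi-output device of the printed size yields each output bit within the same
  size/depth budget, so the typed solver classes CONTAIN print's; "`∉ MODEL[n^a · poly(s(m))]`" ↦
  "for no `k` solvable a.e. in `m` at size `n^a · s(m)^k + k`" (`¬ ∃ k, ∀ᶠ m, …`: i.o. hardness, the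
  reading of `thm16_item1..5`); regime `m ≤ s(m) ≤ 2^{(1−Ω(1))m}` ↦ `SizeRegime s`; for `search-MKtP`
  the regime `log n ≤ p(n) ≤ n^{1−Ω(1)}` ↦ `KtRegime p` and solvability is asked at every large LENGTH
  `n` (as `thm16_MKtP_item1`; Lemma 5.1 of the paper works at every length).
* Item 6: `∀ m*` even, `2 ≤ m*`, `∀ d`; hypothesis at depth `d + 2`, conclusion at depth `d`.
* Item 7: the `O(log 1/ε)` is an absolute constant (Chen–Tell code, TR19-118 §4.1), hence `∃ c₀`
  OUTERMOST exactly as in `thm11_item7_NP`, with the same depth function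
  `tcDepth c₀ d ε = d + c₀(⌈log₂ 1/ε⌉ + 1)` and `ε ∈ (0,1)` (restricting `ε` weakens the typed fact);
  "for all small enough β > 0" ↦ `∃ β₀ > 0, ∀ β ∈ (0, β₀)`; `search-MCSP[2^{βm}]` ↦ parameter
  `twoPowFloor β m = ⌊2^{βm}⌋`; `search-MKtP[2^{βm}] = search-MKtP[n^β]` ↦ `rpowFloor β n = ⌊n^β⌋`;
  `n^{1+ε}` wires ↦ `powCeil (1+ε) n = ⌈n^{1+ε}⌉`.
* CONCLUSIONS, `C = PSPACE` (the weakest printed choice with a tree decl; `⊕P`, `PP` have none) and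
  `C = EXP` for `search-MKtP`: "`C ⊄ MODEL[poly(n)]`" ↦ `∃ L ∈ C, ∀ k, L ∉ MODELae (n ↦ n^k)` over the
  tree's a.e. language classes (`FORMULAae` — print's `Formula` is De Morgan formulas by leaves —,
  `BPSIZEae`, `ACdModSIZEae m* d`, `TCdWIRESae d`): `PSPACENotInFormulaPoly` (existing),
  `PSPACENotInACdModPoly`, `PSPACENotInTCdPoly`, `EXPNotInFormulaPoly` (existing, this namespace),
  `OliveiraPichSanthanam2019.EXPNotInBPPoly` (existing), `EXPNotInACdModPoly`, `EXPNotInTCdPoly`.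
* NON-VACUITY (F1): each class contains the projections (`input_mem_*`; for `formulaXorFns` as soon as
  `s n ≥ 1`), solvability by all functions holds (`searchMCSPSolvableAt_univ`,
  `searchMKtPSolvableAt_univ`), classes are monotone (`*_mono`), and De Morgan formulas are
  Formula-⊕'s (`deMorganFormulaFns_subset_formulaXorFns`: a Formula-⊕ lower bound is the STRONGER
  statement, so decision-side De Morgan bounds do not transfer to item 2 — only `Formula ∘ XOR` bounds do).

All `thm16_*` below are named `Prop`s — OPEN implications, never asserted; the census file
`MagnificationGapCensus.lean` (row R52, items 2/6/7) takes them as hypotheses.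
-/

namespace Literature.Computability.MetaComplexity.ChenJinWilliams2019

open Finset Filter _root_.Computability Literature.Computability.Complexity
open Literature.Computability.Complexity.Nondeterministic Literature.Computability.MetaComplexity

/-! ### The three device classes -/

/-- `U₂-Formula-⊕[s]` at length `n`: functions computed by a formula over
`formulaXorBasis = deMorganBasis ∪ parityGates` with parity gates only at the bottom and parity-leaf
count `≤ s n` (the per-length constraint of `FORMULAXORae s`). [cite: ChenJinWilliams2019, Thm. 1.6 item 2 (U₂-Formula-⊕[s]), TR19-118 p. 5] -/
def formulaXorFns (s : ℕ → ℕ) : ∀ n : ℕ, Set ((Fin n → Bool) → Bool) :=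
  ChenJinWilliams2020.circuitFns fun n C =>
    C.IsOver formulaXorBasis ∧ C.IsFormula ∧ C.XorAtBottom ∧ C.xorLeafCount ≤ s n

/-- `AC_d[m*][M]` at length `n`: functions computed by a circuit over `accBasis m*` (`¬, ∧ₖ, ∨ₖ,
MOD_{m*,k}`, unbounded fan-in) of `acDepth ≤ d` with at most `M n` gates (the per-length constraint of
`ACdModSIZEae m* d M`). [cite: ChenJinWilliams2019, Thm. 1.6 item 6 (AC_{d+2}[m*][s]), TR19-118 p. 5] -/
def acModFns (mStar d : ℕ) (M : ℕ → ℕ) : ∀ n : ℕ, Set ((Fin n → Bool) → Bool) :=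
  ChenJinWilliams2020.circuitFns fun n C => C.IsOver (accBasis mStar) ∧ C.acDepth ≤ d ∧ C.size ≤ M n

/-- `TC_d[w]` at length `n` (size = WIRES): functions computed by a circuit over linear threshold
gates of `acDepth ≤ d` with at most `w n` wires (the per-length constraint of `TCdWIRESae d w`).
[cite: ChenJinWilliams2019, Thm. 1.6 item 7 (TC_{d+O(log 1/ε)}[n^{1+ε}]), TR19-118 p. 5] -/
def tcWireFns (d : ℕ) (w : ℕ → ℕ) : ∀ n : ℕ, Set ((Fin n → Bool) → Bool) :=
  ChenJinWilliams2020.circuitFns fun n C => C.IsOver ltfBasis ∧ C.acDepth ≤ d ∧ C.wires ≤ w n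

/-- The size parameter `2^{βm}` of item 7 as an integer threshold `⌊2^{βm}⌋`.
[cite: ChenJinWilliams2019, Thm. 1.6 item 7 (search-MCSP[2^{βm}])] -/
noncomputable def twoPowFloor (β : ℝ) (m : ℕ) : ℕ := ⌊(2 : ℝ) ^ (β * m)⌋₊

/-- The `Kt` threshold `2^{βm} = n^β` of item 7 for `search-MKtP` at length `n`, as `⌊n^β⌋`.
[cite: ChenJinWilliams2019, Thm. 1.6 item 7, Moreover clause (search-MKtP[2^{βm}])] -/
noncomputable def rpowFloor (β : ℝ) (n : ℕ) : ℕ := ⌊(n : ℝ) ^ β⌋₊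

/-! ### The printed conclusions as tree statements -/

/-- `PSPACE ⊄ AC_d[m*][poly]`: some `PSPACE` language is outside `ACdModSIZEae m* d (n ↦ n^k)` for every
`k`. [cite: ChenJinWilliams2019, Thm. 1.6 item 6 (conclusion, C = PSPACE)] -/
def PSPACENotInACdModPoly (mStar d : ℕ) : Prop :=
  ∃ L ∈ PSPACE, ∀ k : ℕ, L ∉ ACdModSIZEae mStar d fun n => n ^ k

/-- `PSPACE ⊄ TC_d[poly]` (wires): some `PSPACE` language is outside `TCdWIRESae d (n ↦ n^k)` for every
`k`. [cite: ChenJinWilliams2019, Thm. 1.6 item 7 (conclusion, C = PSPACE)] -/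
def PSPACENotInTCdPoly (d : ℕ) : Prop :=
  ∃ L ∈ PSPACE, ∀ k : ℕ, L ∉ TCdWIRESae d fun n => n ^ k

/-- `EXP ⊄ AC_d[m*][poly]`. [cite: ChenJinWilliams2019, Thm. 1.6 item 6, Moreover clause (conclusion, C = EXP)] -/
def EXPNotInACdModPoly (mStar d : ℕ) : Prop :=
  ∃ L ∈ EXP, ∀ k : ℕ, L ∉ ACdModSIZEae mStar d fun n => n ^ k

/-- `EXP ⊄ TC_d[poly]` (wires). [cite: ChenJinWilliams2019, Thm. 1.6 item 7, Moreover clause (conclusion, C = EXP)] -/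
def EXPNotInTCdPoly (d : ℕ) : Prop :=
  ∃ L ∈ EXP, ∀ k : ℕ, L ∉ TCdWIRESae d fun n => n ^ k

/-! ### Theorem 1.6, items 2, 6, 7 for `search-MCSP`, `C = PSPACE` -/

/-- **Thm. 1.6 item 2, `C = PSPACE`**: *"If search-MCSP[s(m)] ∉ U₂-Formula-⊕[n · poly(s(m))], then
C ⊄ Formula[poly(n)]."* Typed: for `s` in the regime, if for NO `k` `search-MCSP[s]` is solved (a.e.
in `m`) by tuples of Formula-⊕'s of `n·s(m)^k + k` leaves, then `PSPACE ⊄ Formula[poly]`. OPEN — a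
named `Prop`. [cite: ChenJinWilliams2019, Thm. 1.6 item 2 (C = PSPACE), TR19-118 p. 5 L18] -/
def thm16_item2 : Prop :=
  ∀ s : ℕ → ℕ, SizeRegime s →
    (¬ ∃ k : ℕ, ∀ᶠ m : ℕ in atTop,
        SearchMCSPSolvableAt (formulaXorFns fun n => n * s m ^ k + k) s m) →
    PSPACENotInFormulaPoly

/-- **Thm. 1.6 item 6, `C = PSPACE`**: *"If search-MCSP[s(m)] ∉ AC_{d+2}[m*][n · poly(s(m))], then
C ⊄ AC_d[m*][poly(n)], for all constants d and even integers m* ≥ 2."* OPEN — a named `Prop`.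
[cite: ChenJinWilliams2019, Thm. 1.6 item 6 (C = PSPACE), TR19-118 p. 5 L22–23] -/
def thm16_item6 : Prop :=
  ∀ mStar : ℕ, Even mStar → 2 ≤ mStar → ∀ d : ℕ, ∀ s : ℕ → ℕ, SizeRegime s →
    (¬ ∃ k : ℕ, ∀ᶠ m : ℕ in atTop,
        SearchMCSPSolvableAt (acModFns mStar (d + 2) fun n => n * s m ^ k + k) s m) →
    PSPACENotInACdModPoly mStar d

/-- **Thm. 1.6 item 7, `C = PSPACE`**: *"If there is an ε > 0 such that, for all small enough β > 0,
search-MCSP[2^{βm}] ∉ TC_{d+O(log 1/ε)}[n^{1+ε}], then C ⊄ TC_d[poly(n)], for all constants d."*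
Typed with the absolute `O(·)`-constant `c₀` outermost (as `thm11_item7_NP`): for every `d` and
`ε ∈ (0,1)`, if for all `β` below some `β₀ > 0` `search-MCSP[⌊2^{βm}⌋]` is not solved (i.o. in `m`) by
tuples of LTF circuits of `acDepth ≤ tcDepth c₀ d ε` and `≤ ⌈n^{1+ε}⌉` wires, then
`PSPACE ⊄ TC_d[poly]`. OPEN — a named `Prop`. [cite: ChenJinWilliams2019, Thm. 1.6 item 7 (C = PSPACE), TR19-118 p. 5 L24–25] -/
def thm16_item7 : Prop :=
  ∃ c₀ : ℕ, ∀ d : ℕ, ∀ ε : ℝ, 0 < ε → ε < 1 →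
    (∃ β₀ : ℝ, 0 < β₀ ∧ ∀ β : ℝ, 0 < β → β < β₀ →
        ¬ ∀ᶠ m : ℕ in atTop,
          SearchMCSPSolvableAt (tcWireFns (tcDepth c₀ d ε) (powCeil (1 + ε))) (twoPowFloor β) m) →
    PSPACENotInTCdPoly d

/-! ### Theorem 1.6 "Moreover": items 2–7 for `search-MKtP`, `C = EXP` -/

section MKtP

variable (U : UniversalMachine)

/-- **Thm. 1.6 item 2 for `search-MKtP`, `C = EXP`**: if `search-MKtP[p(n)]` (regime `KtRegime p`) is
for no `k` solved a.e. by tuples of Formula-⊕'s of `n·p(n)^k + k` leaves, then `EXP ⊄ Formula[poly]`.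
OPEN — a named `Prop`, for the reference machine `U`.
[cite: ChenJinWilliams2019, Thm. 1.6 item 2, Moreover clause (C = EXP), TR19-118 p. 5 L26] -/
def thm16_MKtP_item2 : Prop :=
  ∀ p : ℕ → ℕ, KtRegime p →
    (¬ ∃ k : ℕ, ∀ᶠ n : ℕ in atTop,
        SearchMKtPSolvableAt U (formulaXorFns fun n' => n' * p n ^ k + k) p n) →
    EXPNotInFormulaPoly

/-- **Thm. 1.6 item 3 for `search-MKtP`, `C = EXP`**: `search-MKtP[p(n)] ∉ B₂-Formula[n²·poly(p(n))]`
⇒ `EXP ⊄ Formula[poly]`. [cite: ChenJinWilliams2019, Thm. 1.6 item 3, Moreover clause (C = EXP), TR19-118 p. 5 L26] -/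
def thm16_MKtP_item3 : Prop :=
  ∀ p : ℕ → ℕ, KtRegime p →
    (¬ ∃ k : ℕ, ∀ᶠ n : ℕ in atTop,
        SearchMKtPSolvableAt U (ChenJinWilliams2020.b2FormulaFns fun n' => n' ^ 2 * p n ^ k + k) p n) →
    EXPNotInFormulaPoly

/-- **Thm. 1.6 item 4 for `search-MKtP`, `C = EXP`**: `search-MKtP[p(n)] ∉ U₂-Formula[n³·poly(p(n))]`
⇒ `EXP ⊄ Formula[poly]`. [cite: ChenJinWilliams2019, Thm. 1.6 item 4, Moreover clause (C = EXP), TR19-118 p. 5 L26] -/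
def thm16_MKtP_item4 : Prop :=
  ∀ p : ℕ → ℕ, KtRegime p →
    (¬ ∃ k : ℕ, ∀ᶠ n : ℕ in atTop,
        SearchMKtPSolvableAt U (ChenJinWilliams2020.deMorganFormulaFns fun n' => n' ^ 3 * p n ^ k + k)
          p n) →
    EXPNotInFormulaPoly

/-- **Thm. 1.6 item 5 for `search-MKtP`, `C = EXP`**: `search-MKtP[p(n)] ∉ BP[n²·poly(p(n))]` ⇒
`EXP ⊄ BP[poly]` (`OliveiraPichSanthanam2019.EXPNotInBPPoly`).
[cite: ChenJinWilliams2019, Thm. 1.6 item 5, Moreover clause (C = EXP), TR19-118 p. 5 L26] -/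
def thm16_MKtP_item5 : Prop :=
  ∀ p : ℕ → ℕ, KtRegime p →
    (¬ ∃ k : ℕ, ∀ᶠ n : ℕ in atTop,
        SearchMKtPSolvableAt U (ChenJinWilliams2020.bpFns fun n' => n' ^ 2 * p n ^ k + k) p n) →
    OliveiraPichSanthanam2019.EXPNotInBPPoly

/-- **Thm. 1.6 item 6 for `search-MKtP`, `C = EXP`**: for even `m* ≥ 2` and every `d`,
`search-MKtP[p(n)] ∉ AC_{d+2}[m*][n·poly(p(n))]` ⇒ `EXP ⊄ AC_d[m*][poly]`.
[cite: ChenJinWilliams2019, Thm. 1.6 item 6, Moreover clause (C = EXP), TR19-118 p. 5 L26] -/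
def thm16_MKtP_item6 : Prop :=
  ∀ mStar : ℕ, Even mStar → 2 ≤ mStar → ∀ d : ℕ, ∀ p : ℕ → ℕ, KtRegime p →
    (¬ ∃ k : ℕ, ∀ᶠ n : ℕ in atTop,
        SearchMKtPSolvableAt U (acModFns mStar (d + 2) fun n' => n' * p n ^ k + k) p n) →
    EXPNotInACdModPoly mStar d

/-- **Thm. 1.6 item 7 for `search-MKtP`, `C = EXP`**: with the absolute constant `c₀` outermost, for
every `d` and `ε ∈ (0,1)`: if for all `β` below some `β₀ > 0` `search-MKtP[⌊n^β⌋]` is not solved (i.o.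
in `n`) by tuples of LTF circuits of `acDepth ≤ tcDepth c₀ d ε` and `≤ ⌈n^{1+ε}⌉` wires, then
`EXP ⊄ TC_d[poly]`. [cite: ChenJinWilliams2019, Thm. 1.6 item 7, Moreover clause (C = EXP), TR19-118 p. 5 L26] -/
def thm16_MKtP_item7 : Prop :=
  ∃ c₀ : ℕ, ∀ d : ℕ, ∀ ε : ℝ, 0 < ε → ε < 1 →
    (∃ β₀ : ℝ, 0 < β₀ ∧ ∀ β : ℝ, 0 < β → β < β₀ →
        ¬ ∀ᶠ n : ℕ in atTop,
          SearchMKtPSolvableAt U (tcWireFns (tcDepth c₀ d ε) (powCeil (1 + ε))) (rpowFloor β) n) →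
    EXPNotInTCdPoly d

end MKtP

/-! ### API (all proved): monotonicity, non-vacuity, model inclusions -/

/-- `formulaXorFns` is monotone in the leaf bound. [folklore] -/
theorem formulaXorFns_mono {s s' : ℕ → ℕ} {n : ℕ} (h : s n ≤ s' n) :
    formulaXorFns s n ⊆ formulaXorFns s' n :=
  ChenJinWilliams2020.circuitFns_mono fun _ hC => ⟨hC.1, hC.2.1, hC.2.2.1, hC.2.2.2.trans h⟩

/-- `acModFns` is monotone in depth and size. [folklore] -/
theorem acModFns_mono (mStar : ℕ) {d d' : ℕ} (hd : d ≤ d') {M M' : ℕ → ℕ} {n : ℕ} (hM : M n ≤ M' n) :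
    acModFns mStar d M n ⊆ acModFns mStar d' M' n :=
  ChenJinWilliams2020.circuitFns_mono fun _ hC => ⟨hC.1, hC.2.1.trans hd, hC.2.2.trans hM⟩

/-- `tcWireFns` is monotone in depth and wires. [folklore] -/
theorem tcWireFns_mono {d d' : ℕ} (hd : d ≤ d') {w w' : ℕ → ℕ} {n : ℕ} (hw : w n ≤ w' n) :
    tcWireFns d w n ⊆ tcWireFns d' w' n :=
  ChenJinWilliams2020.circuitFns_mono fun _ hC => ⟨hC.1, hC.2.1.trans hd, hC.2.2.trans hw⟩

/-- Non-vacuity (F1): projections are one-leaf Formula-⊕'s. [folklore] -/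
theorem input_mem_formulaXorFns {s : ℕ → ℕ} {n : ℕ} (hs : 1 ≤ s n) (i : Fin n) :
    (fun x : Fin n → Bool => x i) ∈ formulaXorFns s n :=
  ⟨Circuit.input i, ⟨Circuit.isOver_input formulaXorBasis i, (Circuit.isFormula_input i).1,
    xorAtBottom_input i, by rw [xorLeafCount_input]; exact hs⟩, fun x => Circuit.eval_input i x⟩

/-- Non-vacuity (F1): projections are in every `acModFns m* d M n`. [folklore] -/
theorem input_mem_acModFns (mStar d : ℕ) (M : ℕ → ℕ) {n : ℕ} (i : Fin n) :
    (fun x : Fin n → Bool => x i) ∈ acModFns mStar d M n :=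
  ⟨Circuit.input i, ⟨Circuit.isOver_input (accBasis mStar) i,
    by rw [OliveiraSanthanam2018.acDepth_input]; exact Nat.zero_le _,
    by rw [Circuit.size_input]; exact Nat.zero_le _⟩, fun x => Circuit.eval_input i x⟩

/-- Non-vacuity (F1): projections are in every `tcWireFns d w n` (no wires). [folklore] -/
theorem input_mem_tcWireFns (d : ℕ) (w : ℕ → ℕ) {n : ℕ} (i : Fin n) :
    (fun x : Fin n → Bool => x i) ∈ tcWireFns d w n :=
  ⟨Circuit.input i, ⟨Circuit.isOver_input ltfBasis i,
    by rw [OliveiraSanthanam2018.acDepth_input]; exact Nat.zero_le _,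
    by rw [wires_input]; exact Nat.zero_le _⟩, fun x => Circuit.eval_input i x⟩

/-- De Morgan formulas are Formula-⊕'s with no parity gates (same leaf count): the item-2 device class
CONTAINS the item-4 device class at equal size, so a Formula-⊕ lower bound is the stronger statement.
[folklore] -/
theorem deMorganFormulaFns_subset_formulaXorFns (s : ℕ → ℕ) (n : ℕ) :
    ChenJinWilliams2020.deMorganFormulaFns s n ⊆ formulaXorFns s n :=
  ChenJinWilliams2020.circuitFns_mono fun C hC =>
    ⟨hC.1.mono deMorganBasis_subset_formulaXorBasis, hC.2.1,
      xorAtBottom_of_forall_not_mem fun g hg => not_mem_parityGates_of_mem_deMorganBasis (hC.1 g hg),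
      by rw [xorLeafCount_eq_leafSize_of_isOver_deMorgan hC.1]; exact hC.2.2⟩

/-- `AC_d`-circuits (over `acBasis`) are `AC_d[m*]`-circuits. [folklore] -/
theorem acModFns_of_isOver_acBasis {mStar d : ℕ} {M : ℕ → ℕ} {n : ℕ} {f : (Fin n → Bool) → Bool}
    (h : f ∈ ChenJinWilliams2020.circuitFns (fun n C => C.IsOver acBasis ∧ C.acDepth ≤ d ∧ C.size ≤ M n) n) :
    f ∈ acModFns mStar d M n :=
  ChenJinWilliams2020.circuitFns_mono (fun _ hC => ⟨hC.1.mono (acBasis_subset_accBasis mStar), hC.2⟩) h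

/-- The item-7 hypothesis is ANTITONE in the depth: hardness against `tcWireFns d' w` gives hardness
against `tcWireFns d w` for `d ≤ d'`. [folklore] -/
theorem not_searchMCSPSolvableAt_tcWire_anti {d d' : ℕ} (hd : d ≤ d') {w : ℕ → ℕ} {s : ℕ → ℕ} {m : ℕ}
    (h : ¬ SearchMCSPSolvableAt (tcWireFns d' w) s m) : ¬ SearchMCSPSolvableAt (tcWireFns d w) s m :=
  fun hs => h (hs.mono fun _ => tcWireFns_mono hd le_rfl)

/-- The printed conclusions weaken along `NP ⊆ PSPACE`-type inclusions only through the class; as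
statements, `PSPACENotInTCdPoly d` gives the fixed-polynomial form "for every `k` some `PSPACE`
language is outside `TC_d[n^k]`". [folklore] -/
theorem PSPACENotInTCdPoly.forall_exists {d : ℕ} (h : PSPACENotInTCdPoly d) (k : ℕ) :
    ∃ L ∈ PSPACE, L ∉ TCdWIRESae d fun n => n ^ k :=
  h.elim fun L hL => ⟨L, hL.1, hL.2 k⟩

/-- Likewise for `AC_d[m*]`. [folklore] -/
theorem PSPACENotInACdModPoly.forall_exists {mStar d : ℕ} (h : PSPACENotInACdModPoly mStar d) (k : ℕ) :
    ∃ L ∈ PSPACE, L ∉ ACdModSIZEae mStar d fun n => n ^ k :=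
  h.elim fun L hL => ⟨L, hL.1, hL.2 k⟩

/-- The conclusion of item 7 is ANTITONE in `d` (deeper classes are larger). [folklore] -/
theorem PSPACENotInTCdPoly.anti {d d' : ℕ} (hd : d ≤ d') (h : PSPACENotInTCdPoly d') :
    PSPACENotInTCdPoly d :=
  h.elim fun L hL => ⟨L, hL.1, fun k hk => hL.2 k (TCdWIRESae_mono_depth hd _ hk)⟩

/-- The conclusion of item 6 is ANTITONE in `d`. [folklore] -/
theorem PSPACENotInACdModPoly.anti {mStar d d' : ℕ} (hd : d ≤ d') (h : PSPACENotInACdModPoly mStar d') :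
    PSPACENotInACdModPoly mStar d :=
  h.elim fun L hL => ⟨L, hL.1, fun k hk => hL.2 k (ACdModSIZEae_mono_depth mStar hd _ hk)⟩

end Literature.Computability.MetaComplexity.ChenJinWilliams2019
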